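import Mathlib.Analysis.SpecialFunctions.Pow.Real
import Mathlib.Analysis.SpecialFunctions.Log.Basic
import Mathlib.Analysis.SpecialFunctions.Sqrt
import Mathlib.Analysis.MeanInequalities
import Mathlib.Data.ZMod.Basic
import Literature.Combinatorics.Additive.SliceRankMethod
import Literature.Barriers.MatrixMultiplication.TricoloredSumFreeBarrierProofs
import HarnessLib

/-!
# The growth rate of tri-colored sum-free sets: the Kleinberg–Sawin–Speyer lower bound

Topic `Literature/Combinatorics/Additive` (family `MatrixMultiplication`). Requested by route
`MatrixMultiplication/OctonionicLaser` (support item `F2TricoloredCapacity`,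
`stmt-MatrixMultiplication-7935`; used through `OctLaserBound`): the LOWER bound matching the
slice-rank upper bound of Blasiak–Church–Cohn–Grochow–Naslund–Sawin–Umans 2017, Thm. 4.14 (in tree,
PROVED: `Literature.Barriers.MatrixMultiplication.BCCGNSU2017_thm414_holds`, bound `3|H| J(q)ⁿ`),
vendored as a named fact IN THE TREE'S SPELLING of the constant, so that the two bounds combine.

## The printed statements (held text `paper:arxiv-1607.00047` = Discrete Analysis 2018:12)

p. 3 (§1): "Let `G` be an abelian group. Let `t ∈ Gⁿ`. […] a sum-free set in `Gⁿ` with target `t` is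
a collection of triples `(aᵢ, bᵢ, cᵢ)` in `Gⁿ` such that `aᵢ + bⱼ + c_k = t` if and only if
`i = j = k`. […] The usual terminology is “tri-colored sum-free set” […]. Let `C_q` be the cyclic
group of order `q`. Let `θ = min_{σ>0} (1 + σ + ⋯ + σ^{q−1}) σ^{−(q−1)/3}` and let `ρ` be the value of
`σ` at which the minimum is attained. […] (What we denote `θ` is called `q J(q)` in [BCCGNSU].)
**Theorem 1** ([BCCGNSU]). If `q` is a prime power, then sum-free sets in `C_qⁿ` have size at most
`3 θⁿ`. […] **Theorem 2.** Fix an integer `q ≥ 2`. Define `θ` as above. For `n` sufficiently large,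
there are sum-free sets in `C_qⁿ` with size `≥ θⁿ e^{−2√(2 log 2 log θ · n) − O_q(log n)}`."
(p. 9, **Theorem 13**: the same bound for an arbitrary target `t`; p. 6, **Theorem 4** ([Norin],
[Pebody]): the large-deviation input, conjectured in the preprint and proved by Norin,
arXiv:1608.00243, and Pebody [Peabody2018] — so Thm. 2 is unconditional as published.)

## Lean rendering

* `kssTheta q := q * bccgnsuJ q` — the paper's `θ` in the TREE'S spelling: KSS print the
  identification "`θ = q J(q)`" (p. 3), `bccgnsuJ q = (1/q) inf_{0<x<1} (Σ_{i<q} xⁱ) x^{−(q−1)/3}`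
  being BCCGNSU's rate function (4.10) (`TricoloredSumFreeBarrier.lean`). (The printed `min_{σ>0}` and
  BCCGNSU's `inf_{0<x<1}` agree for `q ≥ 2`: the minimiser `ρ` has `ψ`-mean `(q−1)/3 < (q−1)/2`, so
  `ρ < 1`; we do not need this remark since we adopt the tree's spelling outright.) PROVED here:
  `kssTheta_le` (every `x ∈ (0,1)` bounds `θ_q` above), `le_kssTheta` (uniform lower bounds transfer),
  `le_bccgnsuJ_two` (`(3/4)·2^{1/3} ≤ J(2)`, weighted AM–GM `1 + x = ½ + ½ + x ≥ 3 (x/4)^{1/3}`) and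
  hence, with the tree's `bccgnsuJ_le_J_two`, the exact values `bccgnsuJ_two : J(2) = (3/4)·2^{1/3}`
  and `kssTheta_two : θ₂ = 3/2^{2/3}` (`= 1.88988…`, the Coppersmith–Winograd / Fu–Kleinberg rate).
* `KleinbergSawinSpeyer2018_thm2` — **Thm. 2 as printed**, target `0`: a sum-free set of size `s` in
  `C_qⁿ` is a tricolored sum-free triple `x y z : Fin s → (Fin n → ZMod q)` in the tree's sense
  `Literature.Combinatorics.Additive.IsTricoloredSumFree` (BCCGNSU Def. 3.1:
  `x i + y j + z k = 0 ↔ i = j = k`, literally the printed definition with `t = 0`); "`− O_q(log n)`"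
  in the exponent of a LOWER bound is rendered by a constant `C` depending on `q` only:
  `∃ C n₀, ∀ n ≥ n₀, ∃` a sum-free set of size `s ≥ θⁿ · exp(−2√(2 log 2 · log θ · n) − C log n)`
  (natural logarithms, as in the paper, §3: "All log's are to base e"; `θ_q ≥ 1` so `log θ ≥ 0`).
  This is implied by, and for lower bounds equivalent to, the printed `O_q`-form.

## What is NOT claimed

The theorem itself is not proved (a `provefact` task of size L: §§3–5 of the paper plus
Norin/Pebody). Consumer bookkeeping (`F2TricoloredCapacity` = the fact at `q = 2` ∘ `kssTheta_two` ∘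
absorbing `exp(−c√n − C log n)` into `2^{−εn}`) is left to the prover of that item.

## References

* [KleinbergSawinSpeyer2018] R. Kleinberg, W. Sawin, D. E. Speyer, *The growth rate of tri-colored
  sum-free sets*, Discrete Analysis 2018:12; arXiv:1607.00047 — §1 Thm. 1, Thm. 2 (p. 3), §3 Thm. 4,
  Lemma 5 (p. 6), §5 Thm. 13 (p. 9). (Page = chunk number of the held text.)
* [Peabody2018] L. Pebody, *Proof of a conjecture of Kleinberg–Sawin–Speyer*, Discrete Analysis
  2018:13; S. Norin, *A distribution on triples with maximum entropy marginal*, arXiv:1608.00243.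
* [BlasiakChurchCohnGrochowNaslundSawinUmans2017] J. Blasiak et al., *On cap sets and the
  group-theoretic approach to matrix multiplication*, Discrete Analysis 2017:3 — Def. 3.1, (4.10),
  Thm. 4.14.
-/

noncomputable section

open scoped BigOperators

namespace Literature.Combinatorics.Additive

open Literature.Barriers.MatrixMultiplication (bccgnsuJ bccgnsuJ_le bccgnsuJ_nonneg bccgnsuJ_le_J_two)

/-! ### The constant `θ_q = q · J(q)` -/

/-- **The Kleinberg–Sawin–Speyer constant** `θ_q` (KSS 2018, §1, p. 3:
`θ = min_{σ>0} (1 + σ + ⋯ + σ^{q−1}) σ^{−(q−1)/3}`; "What we denote `θ` is called `qJ(q)` in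
[BCCGNSU]"), in the tree's spelling `q · J(q)` with `J = bccgnsuJ` (BCCGNSU 2017, (4.10)).
`θ₂ = 3/2^{2/3}` (`kssTheta_two`), `θ₃ = 2.755…`. [cite: KleinbergSawinSpeyer2018, §1] -/
def kssTheta (q : ℕ) : ℝ :=
  q * bccgnsuJ q

/-- `0 ≤ θ_q`. [folklore] -/
theorem kssTheta_nonneg (q : ℕ) : 0 ≤ kssTheta q :=
  mul_nonneg (Nat.cast_nonneg q) (bccgnsuJ_nonneg q)

/-- Every `x ∈ (0,1)` gives an upper bound `θ_q ≤ (Σ_{i<q} xⁱ) x^{−(q−1)/3}`.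
[cite: KleinbergSawinSpeyer2018, §1] -/
theorem kssTheta_le {q : ℕ} (hq : 1 ≤ q) {x : ℝ} (hx0 : 0 < x) (hx1 : x < 1) :
    kssTheta q ≤ (∑ i ∈ Finset.range q, x ^ i) * x ^ (-(((q : ℝ) - 1) / 3)) := by
  have hq0 : (0 : ℝ) < q := by exact_mod_cast hq
  have h := bccgnsuJ_le (s := q) hx0 hx1
  rw [le_div_iff₀ hq0] at h
  unfold kssTheta
  linarith [h]

/-- A uniform lower bound of the values `(Σ_{i<q} xⁱ) x^{−(q−1)/3}`, `0 < x < 1`, is a lower bound of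
`θ_q` (for `q ≥ 1`). [folklore] -/
theorem le_kssTheta {q : ℕ} (hq : 1 ≤ q) {b : ℝ}
    (hb : ∀ x : ℝ, 0 < x → x < 1 → b ≤ (∑ i ∈ Finset.range q, x ^ i) * x ^ (-(((q : ℝ) - 1) / 3))) :
    b ≤ kssTheta q := by
  have hq0 : (0 : ℝ) < q := by exact_mod_cast hq
  unfold kssTheta bccgnsuJ
  rw [mul_div_cancel₀ _ hq0.ne']
  refine le_csInf ⟨_, 1 / 2, ⟨by norm_num, by norm_num⟩, rfl⟩ ?_
  rintro _ ⟨x, ⟨hx0, hx1⟩, rfl⟩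
  exact hb x hx0 hx1

/-- The weighted AM–GM step behind `θ₂`: for `x > 0`,
`(3/2)·2^{1/3} ≤ (1 + x)·x^{−1/3}` (from `1 + x = ½ + ½ + x ≥ 3·(¼·x)^{1/3}`, equality at `x = ½`).
[folklore] -/
theorem kss_amgm_two {x : ℝ} (hx : 0 < x) :
    3 / 2 * (2:ℝ) ^ (1 / 3 : ℝ) ≤ (1 + x) * x ^ (-(1 / 3 : ℝ)) := by
  set a : ℝ := (2:ℝ) ^ (1 / 3 : ℝ) with ha
  set b : ℝ := x ^ (1 / 3 : ℝ) with hb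
  have ha0 : 0 < a := Real.rpow_pos_of_pos two_pos _
  have hb0 : 0 < b := Real.rpow_pos_of_pos hx _
  have ha3 : a ^ 3 = 2 := by
    rw [ha, ← Real.rpow_natCast, ← Real.rpow_mul (by norm_num : (0:ℝ) ≤ 2)]; norm_num
  have hhalf : (1 / 2 : ℝ) ^ (1 / 3 : ℝ) = a⁻¹ := by
    rw [ha, ← Real.inv_rpow (by norm_num : (0:ℝ) ≤ 2), one_div]
  have hag := Real.geom_mean_le_arith_mean3_weighted (w₁ := 1/3) (w₂ := 1/3) (w₃ := 1/3)
    (p₁ := 1/2) (p₂ := 1/2) (p₃ := x) (by norm_num) (by norm_num) (by norm_num) (by norm_num)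
    (by norm_num) hx.le (by norm_num)
  rw [hhalf, ← hb] at hag
  have hxneg : x ^ (-(1 / 3 : ℝ)) = b⁻¹ := by rw [Real.rpow_neg hx.le, ← hb]
  rw [hxneg, ← div_eq_mul_inv, le_div_iff₀ hb0]
  -- `hag : a⁻¹ * a⁻¹ * b ≤ 1/3·(1/2) + 1/3·(1/2) + 1/3·x`, and `(3/2)·a·b = 3·a⁻¹·a⁻¹·b` as `a³ = 2`.
  have hkey : 3 / 2 * a * b = 3 * (a⁻¹ * a⁻¹ * b) := by
    rw [show (3:ℝ) * (a⁻¹ * a⁻¹ * b) = 3 * b * (a ^ 2)⁻¹ by ring,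
      eq_mul_inv_iff_mul_eq₀ (pow_ne_zero 2 ha0.ne')]
    linear_combination (3 / 2 * b) * ha3
  rw [hkey]
  linarith [hag]

/-- **`(3/4)·2^{1/3} ≤ J(2)`**: the lower half of `J(2) = (3/4)·2^{1/3} = e^{−δ}` (BCCGNSU 2017,
proof of Thm. A′; the tree has the upper half `bccgnsuJ_le_J_two`).
[cite: BlasiakChurchCohnGrochowNaslundSawinUmans2017, Thm. A′ (proof)] -/
theorem le_bccgnsuJ_two : 3 / 4 * (2:ℝ) ^ (1 / 3 : ℝ) ≤ bccgnsuJ 2 := by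
  unfold bccgnsuJ
  rw [le_div_iff₀ (by norm_num : (0:ℝ) < (2:ℕ))]
  refine le_csInf ⟨_, 1 / 2, ⟨by norm_num, by norm_num⟩, rfl⟩ ?_
  rintro _ ⟨x, ⟨hx0, -⟩, rfl⟩
  dsimp only
  have h := kss_amgm_two hx0
  have hsum : (∑ i ∈ Finset.range 2, x ^ i) = 1 + x := by
    simp [Finset.sum_range_succ]
  have hexp : (-((((2:ℕ) : ℝ) - 1) / 3)) = (-(1 / 3 : ℝ)) := by norm_num
  rw [hsum, hexp]
  have h2 : ((2:ℕ) : ℝ) = 2 := by norm_num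
  rw [h2]
  linarith [h]

/-- **`J(2) = (3/4)·2^{1/3}`** (`= e^{−δ} = 0.94494…`). [cite: BlasiakChurchCohnGrochowNaslundSawinUmans2017, Thm. A′ (proof)] -/
theorem bccgnsuJ_two : bccgnsuJ 2 = 3 / 4 * (2:ℝ) ^ (1 / 3 : ℝ) :=
  le_antisymm (bccgnsuJ_le_J_two le_rfl) le_bccgnsuJ_two

/-- **`θ₂ = 3/2^{2/3}`** (`= 2·J(2) = (3/2)·2^{1/3} = 1.88988…`; KSS 2018, §1: the `q = 2` value of
`θ`, the Coppersmith–Winograd / Fu–Kleinberg rate for `𝔽₂ⁿ`). [cite: KleinbergSawinSpeyer2018, §1] -/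
theorem kssTheta_two : kssTheta 2 = 3 / (2:ℝ) ^ (2 / 3 : ℝ) := by
  unfold kssTheta
  rw [bccgnsuJ_two]
  have h2 : (0:ℝ) < (2:ℝ) ^ (2 / 3 : ℝ) := Real.rpow_pos_of_pos two_pos _
  rw [eq_div_iff h2.ne']
  have hmul : (2:ℝ) ^ (1 / 3 : ℝ) * (2:ℝ) ^ (2 / 3 : ℝ) = 2 := by
    rw [← Real.rpow_add two_pos]; norm_num
  push_cast
  linear_combination (3 / 2) * hmul

/-! ### Theorem 2 -/

/-- **Kleinberg–Sawin–Speyer 2018, Theorem 2** (p. 3: "Fix an integer `q ≥ 2`. Define `θ` as above.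
For `n` sufficiently large, there are sum-free sets in `C_qⁿ` with size
`≥ θⁿ e^{−2√(2 log 2 log θ · n) − O_q(log n)}`"; the same with an arbitrary target is Thm. 13, p. 9;
unconditional as published, the large-deviation input Thm. 4 being Norin's and Pebody's theorem).
Here a sum-free set of size `s` in `C_qⁿ` (target `0`) is a tricolored sum-free triple
`x y z : Fin s → (Fin n → ZMod q)` (`IsTricoloredSumFree`: `x i + y j + z k = 0 ↔ i = j = k`),
`θ = kssTheta q = q·J(q)` (KSS p. 3), and `− O_q(log n)` is a constant `C = C(q)`: size
`≥ θⁿ · exp(−2√(2 · log 2 · log θ · n) − C · log n)` for all `n ≥ n₀(q)` (natural logarithms).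
Together with BCCGNSU Thm. 4.14 (`≤ 3|H| J(q)ⁿ = 3 θⁿ` for `H = C_qⁿ`, in tree) this says that the
tricolored sum-free capacity of `C_q` is exactly `θ_q`; `θ₂ = 3/2^{2/3}` (`kssTheta_two`).
Grounds `Summit.MatrixMultiplication.MatrixMultiplication.Theses.OctonionicLaser.F2TricoloredCapacity`
(item = fact at `q = 2` ∘ `kssTheta_two` ∘ absorbing the subexponential factor into `2^{−εN}`).
Known theorem; statement only. [cite: KleinbergSawinSpeyer2018, Thm. 2] -/
def KleinbergSawinSpeyer2018_thm2 : Prop :=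
  ∀ q : ℕ, 2 ≤ q → ∃ C : ℝ, ∃ n₀ : ℕ, ∀ n : ℕ, n₀ ≤ n →
    ∃ (s : ℕ) (x y z : Fin s → (Fin n → ZMod q)),
      IsTricoloredSumFree x y z ∧
        kssTheta q ^ n *
            Real.exp (-(2 * Real.sqrt (2 * Real.log 2 * Real.log (kssTheta q) * n)) -
              C * Real.log n) ≤ (s : ℝ)

end Literature.Combinatorics.Additive

end
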